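import Summits.NavierStokesRegularity.NavierStokesRegularity.Theses.AdaptedFrequency
import Summits.NavierStokesRegularity.NavierStokesRegularity.Theorems.AdaptedFrequencyAdaptedFrequencyConvergesStubHullTransfer
import Summits.NavierStokesRegularity.NavierStokesRegularity.Theorems.AdaptedFrequencyAdaptedFrequencyConvergesStubPinchingLower
import Summits.NavierStokesRegularity.NavierStokesRegularity.Theorems.AdaptedFrequencyAdaptedFrequencyConvergesStubPinchingUpper
import HarnessLib

/-!
# `TangentFlowTransfer` proved unconditionally, via two-sided pinching
# (route `AdaptedFrequency`, item `TangentFlowTransfer`, stmt-NavierStokesRegularity-10494)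

All results proved. The item `TangentFlowTransfer` (Type-I compactness at a backward-singular
point carries the adapted kernel `G`, the adapted enstrophy `H` and the adapted frequency `Λ` to a
tangent flow with `H̄ > 0` and `Λ̄ ≡ lim Λ`) was previously reduced to a NON-DEGENERACY hypothesis
on the blow-up limit (`tangentFlowTransfer_of_hyp`, `tangentFlowTransfer_of_persistence`). That
hypothesis is now free: the two-sided PINCHING `c₀ ≤ (T − t)² H(t) ≤ C₁` of the adapted enstrophy
on a final window (`stub_pinchingLower`, `stub_pinchingUpper`, line `tauberian-omega-limit` of
crux `AdaptedFrequencyConverges`) is scale invariant, hence passes to EVERY Type-I zoom limit at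
the singular point and gives `H̄(τ) ≥ c₀/τ² > 0` for all `τ < 0`.

Proof (copy of the structure of `hullTransfer_unit` / `stub_hullTransfer`, line
`cloud-frame-effective-tsai`):

1. common pinching window from the two landed stubs (`tangentFlowTransfer_pinching`);
2. zoom about `(T, x₀)` along the scales `c_k = 1/(k+1)` after viscosity normalisation
   (`hullTransfer_zoomData`): classical unit-viscosity Type-I Oseen-mild fields on windows
   `[A_k, 0)`, `A_k → −∞`, adapted kernels with fixed Gaussian constants, EXACT frequency
   covariance `Λ_k(τ) = Λ(T + c_k² τ/ν)` and transported pinching;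
3. since `T + c_k² τ/ν ↑ T` strictly from below (`tangentFlowTransfer_tendsto_zoomTime`),
   `Λ_k(τ) → Λ₀` for every `τ < 0`;
4. `C²_loc` compactness (`exists_tendsto_of_typeI_oseenMild_windows`), kernel stability
   (`kernelStability`, `isAdaptedBackwardKernel_of_limit`), one pressure
   (`exists_isClassicalNSSolutionOn_Iio_of_isTypeIAncientMild`);
5. `H_k(τ) → H̄(τ)` (`hullTransfer_tendsto_enstrophy_frequency`), so the limit is pinched from
   below and `H̄ > 0`; then `Λ̄ ≡ Λ₀` (`adaptedFrequency_limit_eq`);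
6. time dilation back to viscosity `ν` (`AdaptedFrequencyTangentFlowTransferDilation`), which
   keeps positivity of `H̄` and constancy of `Λ̄`.
-/

noncomputable section

open MeasureTheory Set Function Filter TopologicalSpace Metric
open scoped Topology

namespace Summit.NavierStokesRegularity.NavierStokesRegularity.Theorems

open Literature.Analysis Literature.Analysis.FluidPDE
open Summit.NavierStokesRegularity.NavierStokesRegularity.Theorems.AdaptedFrequencyConverges.CloudFrameEffectiveTsai
open Summit.NavierStokesRegularity.NavierStokesRegularity.Theorems.AdaptedFrequencyConverges.TauberianOmegaLimit

/-- **Step 1: two-sided pinching on a common final window.** Under the hypotheses of the item,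
the lower pinching `c₀ ≤ (T − t)² H(t)` (`stub_pinchingLower`) and the upper pinching
`(T − t)² H(t) ≤ C₁` (`stub_pinchingUpper`) hold simultaneously on `[t₁, T)` for
`t₁ = max t₁ₗ t₁ᵤ`. [folklore] -/
theorem tangentFlowTransfer_pinching {ν T : ℝ} (hν : 0 < ν) (hT : 0 < T)
    {u : ℝ → EuclideanSpace ℝ (Fin 3) → EuclideanSpace ℝ (Fin 3)}
    {p : ℝ → EuclideanSpace ℝ (Fin 3) → ℝ} (hcl : IsClassicalNSSolutionOn (Ico 0 T) ν 0 u p)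
    (hLH : IsLerayHopfOn T ν 0 (u 0) u) (hdec : HasRapidSpatialDecay (u 0))
    (hTI : IsTypeIBlowup u T) {x₀ : EuclideanSpace ℝ (Fin 3)} {t₀ : ℝ} (ht₀ : t₀ ∈ Ico 0 T)
    (hsing : ∀ r : ℝ, 0 < r → eLpNorm (uncurry u) ⊤
      (volume.restrict (parabolicCylinder r ((T, x₀) : ℝ × EuclideanSpace ℝ (Fin 3)))) = ⊤)
    {G : ℝ → EuclideanSpace ℝ (Fin 3) → ℝ} (hK : IsAdaptedBackwardKernel ν u (Ico t₀ T) T x₀ G)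
    (hGc : IsGaussianComparable G (Ico t₀ T) T x₀) :
    ∃ t₁ ∈ Ico t₀ T, ∃ c₀ C₁ : ℝ, 0 < c₀ ∧ ∀ t ∈ Ico t₁ T,
      c₀ ≤ (T - t) ^ 2 * adaptedEnstrophy u G t ∧ (T - t) ^ 2 * adaptedEnstrophy u G t ≤ C₁ := by
  obtain ⟨tl, htl, c₀, hc₀, hlow⟩ :=
    stub_pinchingLower ν T u p x₀ t₀ G hν hT hcl hLH hdec hTI ht₀ hsing hK hGc
  obtain ⟨tu, htu, C₁, hup⟩ :=
    stub_pinchingUpper ν T u p x₀ t₀ G hν hT hcl hLH hdec hTI ht₀ hsing hK hGc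
  refine ⟨max tl tu, ⟨le_trans htl.1 (le_max_left _ _), max_lt htl.2 htu.2⟩, c₀, C₁, hc₀,
    fun t ht => ⟨hlow t ⟨(le_max_left _ _).trans ht.1, ht.2⟩,
      hup t ⟨(le_max_right _ _).trans ht.1, ht.2⟩⟩⟩

/-- **Step 3: the zoom times tend to the blow-up time strictly from below.** For `τ < 0`,
`ν > 0` and scales `c_k → 0⁺`, `T + c_k² τ/ν → T` within `(−∞, T)`. [folklore] -/
theorem tangentFlowTransfer_tendsto_zoomTime (T : ℝ) {ν τ : ℝ} (hν : 0 < ν) (hτ : τ < 0)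
    {c : ℕ → ℝ} (hc : ∀ k, 0 < c k) (hc0 : Tendsto c atTop (𝓝 0)) :
    Tendsto (fun k => T + c k ^ 2 * τ / ν) atTop (𝓝[<] T) := by
  have h1 : Tendsto (fun k => T + c k ^ 2 * τ / ν) atTop (𝓝 (T + 0 ^ 2 * τ / ν)) :=
    tendsto_const_nhds.add (((hc0.pow 2).mul_const τ).div_const ν)
  rw [zero_pow two_ne_zero, zero_mul, zero_div, add_zero] at h1
  refine tendsto_nhdsWithin_iff.2 ⟨h1, Eventually.of_forall fun k => ?_⟩
  show T + c k ^ 2 * τ / ν < T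
  have : c k ^ 2 * τ / ν < 0 :=
    div_neg_of_neg_of_pos (mul_neg_of_pos_of_neg (pow_pos (hc k) 2) hτ) hν
  linarith

/-- **Steps 2–5 at unit viscosity: the non-degenerate tangent pair with constant frequency.**
Under the hypotheses of the item (Type-I classical Leray–Hopf solution, adapted kernel on
`[t₀, T)` under two-sided Gaussian bounds, adapted frequency `Λ → Λ₀` as `t ↑ T`) and two-sided
pinching on `[t₁, T)`, there are a constant `C₀`, a classical unit-viscosity solution `(W, q)`
on `(−∞, 0)` with `‖W‖ ≤ C₀/√(−t)`, and an adapted kernel `K` of `W` on `(−∞, 0)` with pole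
`(0, 0)` under two-sided Gaussian bounds, whose adapted enstrophy is positive and whose adapted
frequency is identically `Λ₀` on `(−∞, 0)`. [folklore] -/
theorem tangentFlowTransfer_unit {ν T : ℝ} (hν : 0 < ν) (hT : 0 < T)
    {u : ℝ → EuclideanSpace ℝ (Fin 3) → EuclideanSpace ℝ (Fin 3)}
    {p : ℝ → EuclideanSpace ℝ (Fin 3) → ℝ} (hcl : IsClassicalNSSolutionOn (Ico 0 T) ν 0 u p)
    (hLH : IsLerayHopfOn T ν 0 (u 0) u) (hTI : IsTypeIBlowup u T)
    {x₀ : EuclideanSpace ℝ (Fin 3)} {t₀ : ℝ} (ht₀ : t₀ ∈ Ico 0 T)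
    {G : ℝ → EuclideanSpace ℝ (Fin 3) → ℝ} (hK : IsAdaptedBackwardKernel ν u (Ico t₀ T) T x₀ G)
    {a₁ a₂ A₁ A₂ : ℝ} (ha₁ : 0 < a₁) (ha₂ : 0 < a₂) (hA₁ : 0 < A₁) (hA₂ : 0 < A₂)
    (hGb : ∀ t ∈ Ico t₀ T, ∀ x,
      a₁ * (T - t) ^ (-(3:ℝ) / 2) * Real.exp (-(‖x - x₀‖ ^ 2) / (a₂ * (T - t))) ≤ G t x ∧
        G t x ≤ A₁ * (T - t) ^ (-(3:ℝ) / 2) * Real.exp (-(‖x - x₀‖ ^ 2) / (A₂ * (T - t))))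
    {t₁ c₀ C₁ : ℝ} (ht₁ : t₁ ∈ Ico t₀ T) (hc₀ : 0 < c₀)
    (hpinch : ∀ t ∈ Ico t₁ T, c₀ ≤ (T - t) ^ 2 * adaptedEnstrophy u G t ∧
      (T - t) ^ 2 * adaptedEnstrophy u G t ≤ C₁)
    {Λ₀ : ℝ} (hlim : Tendsto (adaptedFrequency u G T) (𝓝[<] T) (𝓝 Λ₀)) :
    ∃ (C₀ : ℝ) (W : ℝ → EuclideanSpace ℝ (Fin 3) → EuclideanSpace ℝ (Fin 3))
      (q : ℝ → EuclideanSpace ℝ (Fin 3) → ℝ) (K : ℝ → EuclideanSpace ℝ (Fin 3) → ℝ),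
      IsClassicalNSSolutionOn (Iio 0) 1 0 W q ∧
      (∀ t ∈ Iio (0:ℝ), ∀ x, ‖W t x‖ ≤ C₀ / Real.sqrt (-t)) ∧
      IsAdaptedBackwardKernel 1 W (Iio 0) 0 0 K ∧
      (∀ t ∈ Iio (0:ℝ), ∀ x,
        (a₁ * ν ^ ((3:ℝ) / 2)) * ((0:ℝ) - t) ^ (-(3:ℝ) / 2) *
            Real.exp (-(‖x - (0 : EuclideanSpace ℝ (Fin 3))‖ ^ 2) / ((a₂ / ν) * ((0:ℝ) - t))) ≤
          K t x ∧
        K t x ≤ (A₁ * ν ^ ((3:ℝ) / 2)) * ((0:ℝ) - t) ^ (-(3:ℝ) / 2) *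
            Real.exp (-(‖x - (0 : EuclideanSpace ℝ (Fin 3))‖ ^ 2) / ((A₂ / ν) * ((0:ℝ) - t)))) ∧
      (∀ τ ∈ Iio (0:ℝ), 0 < adaptedEnstrophy W K τ) ∧
      (∀ τ ∈ Iio (0:ℝ), adaptedFrequency W K 0 τ = Λ₀) := by
  -- a Type-I window
  obtain ⟨Cu, tu, htuT, hI⟩ := exists_window_of_isTypeIBlowup hTI
  -- the scales `c_k = 1/(k+1) → 0⁺`
  set c : ℕ → ℝ := fun k => 1 / ((k:ℝ) + 1) with hcdef
  have hc : ∀ k, 0 < c k := fun k => one_div_nat_succ_pos k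
  have hc0 : Tendsto c atTop (𝓝 0) := tendsto_one_div_add_atTop_nhds_zero_nat
  -- Step 2: the zoomed, viscosity-normalised data (exact frequency covariance, pinching)
  obtain ⟨C₀, A, w, pw, g, hC₀, hA, -, hclw, hIw, hmildw, hgw, hgb, hfreq, hpin⟩ :=
    hullTransfer_zoomData hν hT hcl hLH htuT hI ht₀ hK hGb hpinch hc hc0
  -- Step 3: the zoomed frequencies converge to `Λ₀` at every `τ < 0`
  have hfreqlim : ∀ τ < 0,
      Tendsto (fun k => adaptedFrequency (w k) (g k) 0 τ) atTop (𝓝 Λ₀) := by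
    intro τ hτ
    refine (hlim.comp (tangentFlowTransfer_tendsto_zoomTime T hν hτ hc hc0)).congr ?_
    intro k
    exact (hfreq k τ).symm
  -- Step 4a: `C²_loc` extraction
  have hcont : ∀ k, ContinuousOn (uncurry (w k)) (Ioo (A k) 0 ×ˢ univ) := fun k =>
    (hclw k).smooth_velocity.continuousOn.mono (prod_mono Ioo_subset_Ico_self Subset.rfl)
  have hwdf : ∀ k, ∀ t ∈ Ioo (A k) 0, IsWeaklyDivFree (w k t) := fun k t ht =>
    VectorCalculus.IsDivFree.isWeaklyDivFree_holds ((hclw k).divFree t (Ioo_subset_Ico_self ht))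
      (contDiff_infty.1 ((hclw k).contDiff_velocity (Ioo_subset_Ico_self ht)) 1)
  obtain ⟨φ, hφ, W, hW, hW0, hW1, hW2⟩ :=
    exists_tendsto_of_typeI_oseenMild_windows hC₀ hA hcont hwdf hmildw hIw
  -- Step 4b: kernel stability along the subsequence
  have hφt : Tendsto φ atTop atTop := hφ.tendsto_atTop
  have ha₁' : 0 < a₁ * ν ^ ((3:ℝ) / 2) := mul_pos ha₁ (Real.rpow_pos_of_pos hν _)
  have hA₁' : 0 < A₁ * ν ^ ((3:ℝ) / 2) := mul_pos hA₁ (Real.rpow_pos_of_pos hν _)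
  have ha₂' : 0 < a₂ / ν := div_pos ha₂ hν
  have hA₂' : 0 < A₂ / ν := div_pos hA₂ hν
  obtain ⟨ψ, hψ, K, hKc, hKeq, hgK⟩ := kernelStability C₀ (a₁ * ν ^ ((3:ℝ) / 2)) (a₂ / ν)
    (A₁ * ν ^ ((3:ℝ) / 2)) (A₂ / ν) (A ∘ φ) (fun k => w (φ k)) (fun k => pw (φ k))
    (fun k => g (φ k)) W hC₀ ha₁' ha₂' hA₁' hA₂' (hA.comp hφt) (fun k => hclw (φ k))
    (fun k => hIw (φ k)) (fun k => hmildw (φ k)) (fun k => hgw (φ k)) (fun k => hgb (φ k))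
    hW hW0 hW1 hW2
  have hψt : Tendsto ψ atTop atTop := hψ.tendsto_atTop
  have hφψt : Tendsto (fun j => φ (ψ j)) atTop atTop := hφt.comp hψt
  obtain ⟨hKW, hKb⟩ := isAdaptedBackwardKernel_of_limit (g := fun j => g (φ (ψ j)))
    (A := fun j => A (φ (ψ j))) (hA.comp hφψt) (fun j => (hgw _).integral_eq_one)
    (fun j t ht => ((hgw _).contDiff_slice ht).continuous) ha₁' hA₂'
    (fun j => hgb (φ (ψ j))) hKc hKeq hgK
  -- Step 4c: one pressure for the tangent flow
  obtain ⟨q, hWcl⟩ := exists_isClassicalNSSolutionOn_Iio_of_isTypeIAncientMild hW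
  -- Step 5a: `H_k(τ) → H̄(τ)` along `j ↦ φ (ψ j)`
  have hHlim := fun (τ : ℝ) (hτ : τ < 0) =>
    (hullTransfer_tendsto_enstrophy_frequency hC₀ (hA.comp hφψt) (fun k => hclw (φ (ψ k)))
      (fun k => hmildw (φ (ψ k))) (fun k => hIw (φ (ψ k))) (fun k => hgw (φ (ψ k))) hA₁'.le hA₂'
      (fun k t ht x => (hgb (φ (ψ k)) t ht x).2) hWcl hKW
      (fun t ht x => (tendsto_at_of_tendstoLocallyUniformly (hW1 t ht) x).comp hψt)
      (fun t ht x => (tendsto_at_of_tendstoLocallyUniformly (hW2 t ht) x).comp hψt) hgK hτ).1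
  -- Step 5b: the limit pair is pinched from below, hence non-degenerate
  have hposW : ∀ τ < 0, 0 < adaptedEnstrophy W K τ := by
    intro τ hτ
    have hH := (hHlim τ hτ).const_mul ((-τ) ^ 2)
    have hev : ∀ᶠ j in atTop, t₁ ≤ T + c (φ (ψ j)) ^ 2 * τ / ν :=
      ((tendsto_nhds_of_tendsto_nhdsWithin (tangentFlowTransfer_tendsto_zoomTime T hν hτ
        (fun j => hc (φ (ψ j))) (hc0.comp hφψt))).eventually
        (eventually_gt_nhds ht₁.2)).mono fun j hj => hj.le
    have h1 : c₀ ≤ (-τ) ^ 2 * adaptedEnstrophy W K τ :=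
      ge_of_tendsto hH (hev.mono fun j hj => (hpin _ τ hτ hj).1)
    exact pos_of_mul_pos_right (hc₀.trans_le h1) (pow_pos (neg_pos.2 hτ) 2).le
  -- Step 5c: transfer of the frequency, `Λ̄ ≡ Λ₀`
  have hΛW : ∀ τ < 0, adaptedFrequency W K 0 τ = Λ₀ :=
    adaptedFrequency_limit_eq hC₀ (hA.comp hφψt) (fun k => hclw (φ (ψ k)))
      (fun k => hmildw (φ (ψ k))) (fun k => hIw (φ (ψ k))) (fun k => hgw (φ (ψ k))) hA₁'.le hA₂'
      (fun k t ht x => (hgb (φ (ψ k)) t ht x).2) hWcl hKW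
      (fun t ht x => (tendsto_at_of_tendstoLocallyUniformly (hW1 t ht) x).comp hψt)
      (fun t ht x => (tendsto_at_of_tendstoLocallyUniformly (hW2 t ht) x).comp hψt) hgK
      (fun τ hτ => (hfreqlim τ hτ).comp hφψt) hposW
  exact ⟨C₀, W, q, K, hWcl, fun t ht x => hW.norm_le ht x, hKW, hKb, fun τ hτ => hposW τ hτ,
    fun τ hτ => hΛW τ hτ⟩

/-- **`TangentFlowTransfer` (item stmt-NavierStokesRegularity-10494), proved.** At a
backward-singular point `(T, x₀)` of a Type-I classical Leray–Hopf solution from a rapidly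
decaying datum, for every flow-adapted, two-sided Gaussian-comparable backward kernel `G` on
`[t₀, T)` whose adapted frequency `Λ(t) = (T − t) H′(t)/H(t)` tends to `Λ₀` as `t ↑ T`, there is
an eternal Type-I pair at viscosity `ν`: a classical solution `(v, q)` of NS on `ℝ³ × (−∞, 0)`
with `‖v(t, x)‖ ≤ C/√(−t)`, an adapted kernel `K` of `v` on `(−∞, 0)` with pole `(0, 0)` (the
five clauses), two-sided Gaussian-comparable, whose adapted enstrophy is positive and whose
adapted frequency is identically `Λ₀` on `(−∞, 0)`. Non-degeneracy comes from the scale-invariant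
pinching of `(T − t)² H` (module docstring). [folklore] -/
theorem adaptedFrequency_tangentFlowTransfer_proof :
    Summit.NavierStokesRegularity.NavierStokesRegularity.Theses.AdaptedFrequency.TangentFlowTransfer := by
  intro ν T hν hT u p hcl hLH hdec hTI x₀ t₀ G ht₀ hsing hK hcomp H Λ hH hΛ Λ₀ hlim
  subst hH hΛ
  -- the kernel clauses and the Gaussian comparability of the item
  have hK' : IsAdaptedBackwardKernel ν u (Ico t₀ T) T x₀ G := isAdaptedBackwardKernel_iff.2 hK
  have hGc : IsGaussianComparable G (Ico t₀ T) T x₀ := isGaussianComparable_iff_fin_three.2 hcomp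
  obtain ⟨a₁, a₂, A₁, A₂, ha₁, ha₂, hA₁, hA₂, hGb⟩ := hcomp
  have hlim' : Tendsto (adaptedFrequency u G T) (𝓝[<] T) (𝓝 Λ₀) := hlim
  -- Step 1: two-sided pinching on a final window
  obtain ⟨t₁, ht₁, c₀, C₁, hc₀, hpinch⟩ :=
    tangentFlowTransfer_pinching hν hT hcl hLH hdec hTI ht₀ hsing hK' hGc
  -- Steps 2–5 at unit viscosity
  obtain ⟨C₀, W, q, K, hWcl, hWI, hKW, hKb, hposW, hΛW⟩ :=
    tangentFlowTransfer_unit hν hT hcl hLH hTI ht₀ hK' ha₁ ha₂ hA₁ hA₂ hGb ht₁ hc₀ hpinch hlim'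
  -- Step 6: back to viscosity `ν`
  have ha₁' : 0 < a₁ * ν ^ ((3:ℝ) / 2) := mul_pos ha₁ (Real.rpow_pos_of_pos hν _)
  have hA₁' : 0 < A₁ * ν ^ ((3:ℝ) / 2) := mul_pos hA₁ (Real.rpow_pos_of_pos hν _)
  have ha₂' : 0 < a₂ / ν := div_pos ha₂ hν
  have hA₂' : 0 < A₂ / ν := div_pos hA₂ hν
  have h3 : Module.finrank ℝ (EuclideanSpace ℝ (Fin 3)) = 3 := finrank_euclideanSpace_fin
  have h3' : ((Module.finrank ℝ (EuclideanSpace ℝ (Fin 3)) : ℕ) : ℝ) = 3 := by rw [h3]; norm_num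
  have hvcl := isClassicalNSSolutionOn_dilate_Iio hWcl hν
  rw [mul_one] at hvcl
  have hKν := isAdaptedBackwardKernel_dilate_Iio hKW hν
  rw [mul_one] at hKν
  have hKνb := gaussian_bounds_dilate_Iio (E := EuclideanSpace ℝ (Fin 3)) (G := K)
    (x₀ := (0 : EuclideanSpace ℝ (Fin 3)))
    (c₁ := a₁ * ν ^ ((3:ℝ) / 2)) (c₂ := a₂ / ν) (C₁ := A₁ * ν ^ ((3:ℝ) / 2)) (C₂ := A₂ / ν) hν
    (by rw [h3']; exact hKb)
  rw [h3'] at hKνb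
  refine ⟨C₀ * Real.sqrt ν, ν • stPull ν 1 0 0 W, ν ^ 2 • stPull ν 1 0 0 q, stPull ν 1 0 0 K,
    hvcl, typeI_bound_dilate hWI hν, hKν.contDiffOn, hKν.pos, hKν.adjoint_eq,
    hKν.integral_eq_one, hKν.tendsto_integral_mul, ?_, ?_⟩
  · -- Gaussian comparability of the dilated kernel
    exact ⟨a₁ * ν ^ ((3:ℝ) / 2) * ν ^ (-(3:ℝ) / 2), a₂ / ν * ν,
      A₁ * ν ^ ((3:ℝ) / 2) * ν ^ (-(3:ℝ) / 2), A₂ / ν * ν,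
      mul_pos ha₁' (Real.rpow_pos_of_pos hν _), mul_pos ha₂' hν,
      mul_pos hA₁' (Real.rpow_pos_of_pos hν _), mul_pos hA₂' hν, hKνb⟩
  · -- positivity of `H̄` and constancy of `Λ̄` are dilation invariant
    rintro _ _ rfl rfl
    exact ⟨adaptedEnstrophy_dilate_pos hposW hν, adaptedFrequency_dilate_const hΛW hν⟩

end Summit.NavierStokesRegularity.NavierStokesRegularity.Theorems

end
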